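import Summits.Langlands.Langlands.Theorems.PicardMuOrdinaryMuOrdinaryFamilyRTThorneCompanionsDebts
import HarnessLib

/-!
# Crux `MuOrdinaryFamilyRT` (stmt-Langlands-13757), line `thorne-minimal-lift`:
# glue gΦ — a CM type of the places above `3`

Registered glue stub `exists_cmType_places_three` of the lead's v7 reduction of
`stub_pointAutomorphicT` (blueprint `Cruxes/MuOrdinaryFamilyRT/Lines/thorne-minimal-lift-pointAutomorphic.md`):
for a CM number field `F'` in which every place `w ∣ 3` is moved by complex conjugation `c`
(`ThreeSplitFromMaximalReal F'`, i.e. every place of `F'⁺` above `3` splits in `F'/F'⁺`), there is a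
finite set `Φ` of places above `3` containing exactly one place out of each pair `{w, c • w}`:
`w ∈ Φ ↔ c • w ∉ Φ` for every `w ∣ 3`.

Proof.  The places above `3` form a finite set `P` (they divide the non-zero ideal `(3)`,
`Ideal.finite_factors`), stable under `c` (`c • 3 = 3`, `HeightOneSpectrum.smul_mem_smul_asIdeal_iff`),
on which `c` is a fixed-point-free involution (`c * c = 1` by `complexConj_apply_apply`; no fixed point
by hypothesis).  Fix any linear order on the places (the well-ordering theorem, `WellOrderingRel`) and
put `Φ := {w ∈ P | w < c • w}`; then for `w ∈ P`, `w ∈ Φ ↔ w < c • w ↔ ¬ (c • w < w) ↔ c • w ∉ Φ` by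
trichotomy and `w ≠ c • w`.
-/

set_option linter.dupNamespace false

namespace Summit.Langlands.Langlands.Cruxes.MuOrdinaryFamilyRT.ThorneMinimalLift

open scoped NumberField Polynomial Matrix Classical
open Field IsDedekindDomain Polynomial
open Literature.NumberTheory.GaloisRepresentations Literature.NumberTheory.Automorphic
open Summit.Langlands.Langlands.Cruxes.MuOrdinaryFamilyRT.CharZeroDominance

noncomputable section

/-- **Glue gΦ (a CM type of the places above `3`).**  If every place `w ∣ 3` of the CM field `F'` is
moved by complex conjugation `c`, there is a finite set `Φ` of places above `3` with
`w ∈ Φ ↔ c • w ∉ Φ` for every `w ∣ 3` (orbit representatives of the fixed-point-free involution `c`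
on the finite set of places above `3`: the smaller element of each pair for an auxiliary linear order). -/
theorem exists_cmType_places_three : ∀ (F' : Type) [Field F'] [NumberField F'] [NumberField.IsCMField F'], ThreeSplitFromMaximalReal F' → ∃ Φ : Finset (HeightOneSpectrum (𝓞 F')), (∀ w ∈ Φ, ((3 : ℕ) : 𝓞 F') ∈ w.asIdeal) ∧ ∀ w : HeightOneSpectrum (𝓞 F'), ((3 : ℕ) : 𝓞 F') ∈ w.asIdeal → (w ∈ Φ ↔ NumberField.IsCMField.complexConj F' • w ∉ Φ) := by
  intro F' _ _ _ hsplit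
  -- complex conjugation is an involution, also on the places
  have hc2 : NumberField.IsCMField.complexConj F' * NumberField.IsCMField.complexConj F' = 1 :=
    AlgEquiv.ext fun x => NumberField.IsCMField.complexConj_apply_apply F' x
  have hcc : ∀ w : HeightOneSpectrum (𝓞 F'),
      NumberField.IsCMField.complexConj F' • NumberField.IsCMField.complexConj F' • w = w := fun w => by
    rw [smul_smul, hc2, one_smul]
  -- conjugate places lie above `3` together
  have h3c : NumberField.IsCMField.complexConj F' • ((3 : ℕ) : 𝓞 F') = ((3 : ℕ) : 𝓞 F') :=
    map_natCast (MulSemiringAction.toRingHom (F' ≃ₐ[NumberField.maximalRealSubfield F'] F') (𝓞 F')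
      (NumberField.IsCMField.complexConj F')) 3
  have h3 : ∀ w : HeightOneSpectrum (𝓞 F'),
      ((3 : ℕ) : 𝓞 F') ∈ (NumberField.IsCMField.complexConj F' • w).asIdeal ↔
        ((3 : ℕ) : 𝓞 F') ∈ w.asIdeal := fun w => by
    simpa only [h3c] using
      HeightOneSpectrum.smul_mem_smul_asIdeal_iff (NumberField.IsCMField.complexConj F') w ((3 : ℕ) : 𝓞 F')
  -- the places above `3` form a finite set
  have hfin : {w : HeightOneSpectrum (𝓞 F') | ((3 : ℕ) : 𝓞 F') ∈ w.asIdeal}.Finite := by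
    have h30 : (Ideal.span {((3 : ℕ) : 𝓞 F')} : Ideal (𝓞 F')) ≠ ⊥ := by
      rw [Ne, Ideal.span_singleton_eq_bot]
      exact Nat.cast_ne_zero.mpr (by norm_num)
    refine (Ideal.finite_factors h30).subset fun w hw => ?_
    simpa only [Set.mem_setOf_eq, Ideal.dvd_span_singleton] using hw
  -- an auxiliary linear order on the places; keep the smaller element of each pair `{w, c • w}`
  letI : LinearOrder (HeightOneSpectrum (𝓞 F')) := IsWellOrder.linearOrder WellOrderingRel
  refine ⟨hfin.toFinset.filter fun w => w < NumberField.IsCMField.complexConj F' • w, fun w hw => ?_,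
    fun w hw => ?_⟩
  · exact hfin.mem_toFinset.mp (Finset.mem_filter.mp hw).1
  · have hne : NumberField.IsCMField.complexConj F' • w ≠ w := hsplit w hw
    have hcw : ((3 : ℕ) : 𝓞 F') ∈ (NumberField.IsCMField.complexConj F' • w).asIdeal := (h3 w).mpr hw
    simp only [Finset.mem_filter, Set.Finite.mem_toFinset, Set.mem_setOf_eq, hw, hcw, true_and, hcc]
    exact ⟨fun h h' => lt_asymm h h', fun h => lt_of_le_of_ne (not_lt.mp h) hne.symm⟩

end

end Summit.Langlands.Langlands.Cruxes.MuOrdinaryFamilyRT.ThorneMinimalLift
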